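import Mathlib
import HarnessLib

/-!
# Stub `stub_dvrClean` for crux stmt-ResolutionOfSingularities-15917 (`RadicialJung.CleanModels`)

Calibration of the crux in dimension one, local algebra at a discrete valuation ring.
Let `O` be a DVR with uniformizer `t` and fraction field `K`, `L ⊋ K` a field of
characteristic `p` with `L^p ⊆ K`, and `B` the integral closure of `O` in `L`; assume `B` is a
DVR (uniformizer `τ`), finite over `O`, with `B^p ⊆ O` and `B ⊄ K`. Then there is
`y ∈ L ∖ K` with `y ^ p = s ∈ O` *clean*: either `s ∈ 𝔪_O ∖ 𝔪_O²`, or `s` is a unit which is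
not a `p`-th power modulo `𝔪_O`.

Proof. Write `t = u τ^e` in `B` and `τ^p = s₀ = w t^n` with `s₀ ∈ O`; comparing exponents of
`τ` gives `p = e n`, so `e = 1` or `e = p`.
* `e = p`, `n = 1`: `s₀ = w t ∈ 𝔪_O ∖ 𝔪_O²` and `y = τ`.
* `e = 1`: `t` is a uniformizer of `B`, so `𝔪_B = t B`. By Nakayama, `B ≠ O + 𝔪_O B`
  (else `B = O ⊆ K`); pick `b ∉ O + t B`. Then `b` is a unit, `b^p = s ∈ O` is a unit, and if
  `s - c^p ∈ 𝔪_O` then `(b - c)^p ∈ t B = 𝔪_B`, so `b - c ∈ t B`, i.e. `b ∈ O + t B`, absurd.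
In both cases `y ∉ K`: otherwise `y ∈ O` (a DVR is integrally closed) and `s = y^p` would be a
`p`-th power in `O`, which cleanness forbids.
-/

set_option linter.dupNamespace false

namespace Summit.ResolutionOfSingularities.ResolutionOfSingularities.Theorems.RadicialJung.CleanModels

/-- **Clean `p`-th roots over a DVR.** For a DVR `O` with fraction field `K`, a field `L` of
characteristic `p` over `K`, and `B = integralClosure O L` a DVR, finite over `O`, with
`B^p ⊆ O` and `B ⊄ K`: there is `y ∈ L ∖ K` with `y^p = s ∈ O` such that either
`s ∈ 𝔪_O ∖ 𝔪_O²`, or `s` is a unit with `s - c^p ∉ 𝔪_O` for all `c ∈ O`. -/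
theorem stub_dvrClean {O K L : Type*} [CommRing O] [IsDomain O] [IsDiscreteValuationRing O]
    [Field K] [Algebra O K] [IsFractionRing O K] [Field L] [Algebra K L] [Algebra O L]
    [IsScalarTower O K L] (p : ℕ) (hp : p.Prime) [CharP L p]
    (hB : IsDiscreteValuationRing (integralClosure O L))
    (hBp : ∀ b : integralClosure O L, ∃ s : O, algebraMap O L s = (b : L) ^ p)
    (hBK : ∃ b : integralClosure O L, (b : L) ∉ Set.range (algebraMap K L))
    (hfin : Module.Finite O (integralClosure O L)) :
    ∃ (y : L) (s : O), y ∉ Set.range (algebraMap K L) ∧ algebraMap O L s = y ^ p ∧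
      ((s ∈ IsLocalRing.maximalIdeal O ∧ s ∉ IsLocalRing.maximalIdeal O ^ 2) ∨
        (IsUnit s ∧ ∀ c : O, s - c ^ p ∉ IsLocalRing.maximalIdeal O)) := by
  haveI : Fact p.Prime := ⟨hp⟩
  haveI := hB
  haveI := hfin
  set B := integralClosure O L
  -- injectivity of the structure maps
  have hinjOL : Function.Injective (algebraMap O L) := by
    rw [IsScalarTower.algebraMap_eq O K L, RingHom.coe_comp]
    exact (algebraMap K L).injective.comp (IsFractionRing.injective O K)
  have hinjOB : Function.Injective (algebraMap O B) := by
    have h := hinjOL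
    rw [IsScalarTower.algebraMap_eq O B L, RingHom.coe_comp] at h
    exact Function.Injective.of_comp h
  haveI : FaithfulSMul O B := (faithfulSMul_iff_algebraMap_injective O B).mpr hinjOB
  haveI : CharP B p := (algebraMap B L).charP Subtype.val_injective p
  -- `hBp` read inside `B`
  have toB : ∀ (b : B) (s : O), algebraMap O L s = (b : L) ^ p → algebraMap O B s = b ^ p := by
    intro b s hs
    apply Subtype.val_injective
    simp only [SubmonoidClass.coe_pow]
    rw [← hs, Subalgebra.coe_algebraMap]
  -- an element of `B` whose `p`-th power `s ∈ O` is not a `p`-th power in `O` is not in `K`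
  have notK : ∀ (y : B) (s : O), algebraMap O L s = (y : L) ^ p → (∀ x : O, s ≠ x ^ p) →
      (y : L) ∉ Set.range (algebraMap K L) := by
    rintro y s hys hsx ⟨x, hx⟩
    have hxint : IsIntegral O x := by
      rw [← isIntegral_algebraMap_iff (B := L) (algebraMap K L).injective, hx]
      exact y.2
    obtain ⟨x', hx'⟩ := IsIntegrallyClosed.algebraMap_eq_of_integral hxint
    refine hsx x' (hinjOL ?_)
    rw [hys, ← hx, ← hx', map_pow, ← IsScalarTower.algebraMap_apply]
  -- it suffices to produce `y ∈ B` and a clean `s ∈ O` with `s = y ^ p`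
  suffices h : ∃ (y : B) (s : O), algebraMap O L s = (y : L) ^ p ∧
      ((s ∈ IsLocalRing.maximalIdeal O ∧ s ∉ IsLocalRing.maximalIdeal O ^ 2) ∨
        (IsUnit s ∧ ∀ c : O, s - c ^ p ∉ IsLocalRing.maximalIdeal O)) by
    obtain ⟨y, s, hys, hclean⟩ := h
    refine ⟨y, s, notK y s hys ?_, hys, hclean⟩
    rintro x rfl
    rcases hclean with ⟨h1, h2⟩ | ⟨-, h2⟩
    · exact h2 (Ideal.pow_le_pow_right hp.two_le (Ideal.pow_mem_pow
        ((IsLocalRing.maximalIdeal.isMaximal O).isPrime.mem_of_pow_mem p h1) p))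
    · exact h2 x (by rw [sub_self]; exact Submodule.zero_mem _)
  -- uniformizers `τ` of `B` and `t` of `O`; ramification index `e`
  obtain ⟨τ, hτ⟩ := IsDiscreteValuationRing.exists_irreducible B
  obtain ⟨t, ht⟩ := IsDiscreteValuationRing.exists_irreducible O
  have htm : t ∈ IsLocalRing.maximalIdeal O :=
    ht.maximalIdeal_eq ▸ Ideal.mem_span_singleton_self t
  have ht0 : algebraMap O B t ≠ 0 := (map_ne_zero_iff _ hinjOB).mpr ht.ne_zero
  obtain ⟨e, u, hu⟩ := IsDiscreteValuationRing.eq_unit_mul_pow_irreducible ht0 hτ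
  -- `τ ^ p = s₀ ∈ O`, `s₀ = w * t ^ n`
  obtain ⟨s₀, hs₀⟩ := hBp τ
  have hs₀B : algebraMap O B s₀ = τ ^ p := toB τ s₀ hs₀
  have hs₀0 : s₀ ≠ 0 := by
    rintro rfl
    rw [map_zero] at hs₀B
    exact hτ.ne_zero ((pow_eq_zero_iff hp.ne_zero).mp hs₀B.symm)
  obtain ⟨n, w, hw⟩ := IsDiscreteValuationRing.eq_unit_mul_pow_irreducible hs₀0 ht
  -- comparing exponents of `τ`: `p = e * n`
  obtain ⟨v, hv⟩ : ∃ v : Bˣ, (v : B) = algebraMap O B w * (u : B) ^ n :=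
    ⟨Units.map (algebraMap O B : O →* B) w * u ^ n, by simp⟩
  have key : ((1 : Bˣ) : B) * τ ^ p = v * τ ^ (e * n) := by
    rw [Units.val_one, one_mul, ← hs₀B, hw, map_mul, map_pow, hu, hv, mul_pow, pow_mul]
    ring
  have hpen : p = e * n := IsDiscreteValuationRing.unit_mul_pow_congr_pow hτ hτ _ _ _ _ key
  rcases hp.eq_one_or_self_of_dvd e (Dvd.intro n hpen.symm) with he | he
  · -- CASE `e = 1`: `t` stays a uniformizer of `B`; a residually new unit exists by Nakayama
    rw [he, pow_one] at hu
    have hirrt : Irreducible (algebraMap O B t) := by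
      rw [hu]
      exact (associated_unit_mul_right τ (u : B) u.isUnit).irreducible hτ
    have hmB : IsLocalRing.maximalIdeal B = Ideal.span {algebraMap O B t} :=
      hirrt.maximalIdeal_eq
    set N : Submodule O B := LinearMap.range (Algebra.linearMap O B) with hNdef
    set M : Submodule O B := N ⊔ IsLocalRing.maximalIdeal O • ⊤ with hMdef
    have hMtop : ¬ (⊤ : Submodule O B) ≤ M := by
      intro hle
      have htop : (⊤ : Submodule O B) ≤ N := Submodule.le_of_le_smul_of_le_jacobson_bot
        Module.Finite.fg_top (IsLocalRing.maximalIdeal_le_jacobson ⊥) hle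
      obtain ⟨b, hb⟩ := hBK
      obtain ⟨x, hx⟩ := htop (Submodule.mem_top (x := b))
      apply hb
      refine ⟨algebraMap O K x, ?_⟩
      rw [← IsScalarTower.algebraMap_apply, IsScalarTower.algebraMap_apply O B L, ← hx]
      rfl
    obtain ⟨b, hb⟩ : ∃ b : B, b ∉ M := by
      by_contra! h
      exact hMtop fun b _ => h b
    have hmem_of_dvd : ∀ c : B, algebraMap O B t ∣ c → c ∈ M := by
      rintro c ⟨d, rfl⟩
      apply Submodule.mem_sup_right
      rw [← Algebra.smul_def]
      exact Submodule.smul_mem_smul htm Submodule.mem_top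
    have hbu : IsUnit b := by
      by_contra hbu
      have hbm : b ∈ IsLocalRing.maximalIdeal B := hbu
      rw [hmB, Ideal.mem_span_singleton] at hbm
      exact hb (hmem_of_dvd b hbm)
    obtain ⟨s, hs⟩ := hBp b
    have hsB : algebraMap O B s = b ^ p := toB b s hs
    have hsu : IsUnit s := by
      rw [← isUnit_map_iff (algebraMap O B) s, hsB]
      exact hbu.pow p
    refine ⟨b, s, hs, Or.inr ⟨hsu, fun c hc => hb ?_⟩⟩
    rw [ht.maximalIdeal_eq, Ideal.mem_span_singleton] at hc
    obtain ⟨d, hd⟩ := hc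
    have hpow : (b - algebraMap O B c) ^ p ∈ IsLocalRing.maximalIdeal B := by
      rw [sub_pow_char, ← hsB, ← map_pow, ← map_sub, hd, map_mul, hmB]
      exact Ideal.mul_mem_right _ _ (Ideal.mem_span_singleton_self _)
    have hb' := (IsLocalRing.maximalIdeal.isMaximal B).isPrime.mem_of_pow_mem p hpow
    rw [hmB, Ideal.mem_span_singleton] at hb'
    have : b = algebraMap O B c + (b - algebraMap O B c) := by ring
    rw [this]
    exact M.add_mem (Submodule.mem_sup_left ⟨c, rfl⟩) (hmem_of_dvd _ hb')
  · -- CASE `e = p`: then `n = 1` and `s₀ = w * t` is a uniformizer of `O` with `p`-th root `τ`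
    subst he
    have hn : n = 1 := by
      have : e * n = e * 1 := by rw [mul_one]; exact hpen.symm
      exact Nat.eq_of_mul_eq_mul_left hp.pos this
    rw [hn, pow_one] at hw
    refine ⟨τ, s₀, hs₀, Or.inl ⟨?_, ?_⟩⟩
    · rw [hw]
      exact Ideal.mul_mem_left _ _ htm
    · rw [ht.maximalIdeal_eq, Ideal.span_singleton_pow, Ideal.mem_span_singleton, hw]
      rintro ⟨c, hc⟩
      refine ht.not_isUnit (isUnit_of_dvd_unit ⟨c, mul_right_cancel₀ ht.ne_zero ?_⟩ w.isUnit)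
      rw [hc]
      ring

end Summit.ResolutionOfSingularities.ResolutionOfSingularities.Theorems.RadicialJung.CleanModels
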